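import Mathlib.MeasureTheory.Integral.DivergenceTheorem
import Mathlib.Analysis.Calculus.BumpFunction.InnerProduct
import Mathlib.Analysis.Calculus.MeanValue
import Mathlib.MeasureTheory.Measure.Haar.InnerProductSpace
import Literature.Analysis.FluidPDE.SpaceTimeCalculusC1
import Literature.Analysis.FunctionSpaces.FlatTorus
import HarnessLib

/-!
# Conservation of cell integrals under tangential incompressible transport

Topic `Literature/Analysis/FluidPDE`. A bookkeeping step of the quasi-self-similar mixing
constructions (Alberti–Crippa–Mazzucato 2019, §6.1 (ii) and Remark 24 (iv); Bruè–De Lellis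
2023, §4.1 (ii): "`⨍ Θ_i(x,t) dx = 0` and `∫ Θ_i² = 1` for every `t ∈ [0,1]`"): if a scalar `H`
is transported, `∂ₜH + V·∇H = 0` on `[a,b] × [0,1]^{n+1}`, by a `C¹` velocity field `V` which is
divergence free on the closed cube and *tangent to its boundary* (the normal component vanishes on
every face), then `t ↦ ∫_{[0,1)^{n+1}} H(t, z) dz` is constant on `[a,b]`; applied to `Φ ∘ Θ`
for a transported `Θ` this gives the conservation of `∫ Θ` and `∫ Θ²` (zero average and unit
`L²` mass of the building blocks for all times from their values at `t = 0`).

Proof: differentiate under the integral (`hasDerivAt_integral_of_contDiffOn`), rewrite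
`∂ₜH = -DH[V] = -div(H V)` (incompressibility) and apply the divergence theorem on the box
(Mathlib `integral_divergence_of_hasFDerivAt_off_countable`, transported from `Fin (n+1) → ℝ`
to `EuclideanSpace ℝ (Fin (n+1))` by the volume-preserving `WithLp.ofLp`): every face term
vanishes because the normal component of `V` does.

Main statements: `integral_unitCube_divergence_eq_zero_of_tangent` (the divergence theorem with
vanishing normal traces), `setIntegral_unitCube_eq_of_transport` (conservation for a transported
`C¹` scalar), `setIntegral_unitCube_comp_eq_of_transport` (for `Φ ∘ Θ`), and the two cases used
by the blocks, `setIntegral_unitCube_eq_of_transport'` (`∫ Θ`) and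
`setIntegral_unitCube_sq_eq_of_transport` (`∫ Θ²`).

## References

* G. Alberti, G. Crippa, A. L. Mazzucato, *Exponential self-similar mixing by incompressible
  flows*, J. Amer. Math. Soc. 32 (2019), Ass. 6.1 (ii), Remark 24 (iv) (arXiv:1605.02090).
* E. Bruè, C. De Lellis, *Anomalous dissipation for the forced 3D Navier–Stokes equations*,
  Comm. Math. Phys. 400 (2023), §4.1 (ii).
* L. C. Evans, *Partial Differential Equations*, 2nd ed., AMS 2010, App. C.2 (Gauss–Green).
-/

noncomputable section

open MeasureTheory Set Filter Function Metric

open scoped Topology ContDiff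

namespace Literature.Analysis.FluidPDE

namespace BoxTransport

open FunctionSpaces FunctionSpaces.Torus

variable {n : ℕ}

/-! ## Pointwise calculus -/

/-- Expansion of a vector of `ℝ^{n+1}` in the standard basis: `w = Σⱼ wⱼ eⱼ`. [folklore] -/
theorem sum_apply_smul_single (w : EuclideanSpace ℝ (Fin (n + 1))) :
    ∑ j, w j • EuclideanSpace.single j (1 : ℝ) = w := by
  have h := (EuclideanSpace.basisFun (Fin (n + 1)) ℝ).sum_repr w
  simpa only [EuclideanSpace.basisFun_repr, EuclideanSpace.basisFun_apply] using h

/-- `Dh(z)[w] = Σⱼ wⱼ ∂ⱼh(z)`. [folklore] -/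
theorem fderiv_apply_eq_sum (h : EuclideanSpace ℝ (Fin (n + 1)) → ℝ)
    (z w : EuclideanSpace ℝ (Fin (n + 1))) :
    fderiv ℝ h z w = ∑ j, w j * fderiv ℝ h z (EuclideanSpace.single j 1) := by
  conv_lhs => rw [← sum_apply_smul_single w]
  simp only [map_sum, map_smul, smul_eq_mul]

/-- **Leibniz rule for the divergence**: `div(h W) = Dh[W] + h div W` at a point of
differentiability. [folklore] -/
theorem sum_fderiv_smul_apply {h : EuclideanSpace ℝ (Fin (n + 1)) → ℝ}
    {W : EuclideanSpace ℝ (Fin (n + 1)) → EuclideanSpace ℝ (Fin (n + 1))} {z : EuclideanSpace ℝ (Fin (n + 1))}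
    (hh : DifferentiableAt ℝ h z)
    (hW : DifferentiableAt ℝ W z) :
    ∑ j, fderiv ℝ (fun y => h y • W y) z (EuclideanSpace.single j 1) j =
      fderiv ℝ h z (W z) + h z * ∑ j, fderiv ℝ W z (EuclideanSpace.single j 1) j := by
  rw [fderiv_fun_smul hh hW, fderiv_apply_eq_sum h z (W z), Finset.mul_sum,
    ← Finset.sum_add_distrib]
  refine Finset.sum_congr rfl fun j _ => ?_
  simp only [add_apply, FunLike.coe_smul, Pi.smul_apply,
    ContinuousLinearMap.smulRight_apply, PiLp.add_apply, PiLp.smul_apply, smul_eq_mul]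
  ring

/-! ## The closed cube -/

/-- The closed unit cube `[0,1]^{n+1}` is the preimage of the box `Icc 0 1` of `ℝ^{n+1}`.
[folklore] -/
theorem setOf_mem_Icc_eq_preimage :
    {z : EuclideanSpace ℝ (Fin (n + 1)) | ∀ k, z k ∈ Icc (0 : ℝ) 1} =
      WithLp.ofLp ⁻¹' Icc (0 : Fin (n + 1) → ℝ) 1 := by
  ext z
  simp only [mem_setOf_eq, mem_preimage, mem_Icc, Pi.le_def, Pi.zero_apply, Pi.one_apply]
  exact ⟨fun h => ⟨fun k => (h k).1, fun k => (h k).2⟩, fun h k => ⟨h.1 k, h.2 k⟩⟩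

/-- The closed unit cube of `ℝ^{n+1}` is compact. [folklore] -/
theorem isCompact_setOf_mem_Icc :
    IsCompact {z : EuclideanSpace ℝ (Fin (n + 1)) | ∀ k, z k ∈ Icc (0 : ℝ) 1} := by
  rw [setOf_mem_Icc_eq_preimage]
  have : WithLp.ofLp ⁻¹' Icc (0 : Fin (n + 1) → ℝ) 1 =
      (WithLp.toLp 2 : (Fin (n + 1) → ℝ) → EuclideanSpace ℝ (Fin (n + 1))) ''
        Icc (0 : Fin (n + 1) → ℝ) 1 := by
    ext z
    constructor
    · intro hz; exact ⟨WithLp.ofLp z, hz, rfl⟩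
    · rintro ⟨x, hx, rfl⟩; exact hx
  rw [this]
  exact isCompact_Icc.image (PiLp.continuous_toLp 2 _)

/-- The half-open cube `[0,1)^{n+1}` lies in the closed cube. [folklore] -/
theorem unitCube_subset_setOf_mem_Icc :
    unitCube (Fin (n + 1)) ⊆ {z : EuclideanSpace ℝ (Fin (n + 1)) | ∀ k, z k ∈ Icc (0 : ℝ) 1} :=
  fun _ hz k => Ico_subset_Icc_self (hz k)

/-- Points of the closed unit cube have norm at most `n + 1`. [folklore] -/
theorem norm_le_of_mem_Icc {z : EuclideanSpace ℝ (Fin (n + 1))} (hz : ∀ k, z k ∈ Icc (0 : ℝ) 1) :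
    ‖z‖ ≤ n + 1 := by
  have hsq : ‖z‖ ^ 2 ≤ (n + 1 : ℝ) := by
    rw [EuclideanSpace.real_norm_sq_eq]
    calc ∑ i, z i ^ 2 ≤ ∑ _i : Fin (n + 1), (1 : ℝ) :=
          Finset.sum_le_sum fun i _ => by
            have := hz i
            nlinarith [this.1, this.2]
      _ = n + 1 := by simp
  have h1 : (n + 1 : ℝ) ≤ (n + 1 : ℝ) ^ 2 := by nlinarith
  nlinarith [norm_nonneg z, hsq.trans h1]

/-! ## The divergence theorem with vanishing normal traces -/

/-- **Gauss–Green on the unit cube with vanishing normal traces**: for a `C¹` vector field `G`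
on `ℝ^{n+1}` whose `j`-th component vanishes on the faces `{z_j = 0}`, `{z_j = 1}` of the
closed unit cube, `∫_{[0,1)^{n+1}} div G = 0` (Mathlib's divergence theorem on the box
`[0,1]^{n+1} ⊂ ℝ^{n+1} = (Fin (n+1) → ℝ)`, transported to `EuclideanSpace` by the
volume-preserving `ofLp`; all face integrals vanish). [cite: Evans2010, App. C.2, Thm. 1] -/
theorem integral_unitCube_divergence_eq_zero_of_tangent
    {G : EuclideanSpace ℝ (Fin (n + 1)) → EuclideanSpace ℝ (Fin (n + 1))} (hG : ContDiff ℝ 1 G)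
    (htan : ∀ z : EuclideanSpace ℝ (Fin (n + 1)), (∀ k, z k ∈ Icc (0 : ℝ) 1) →
      ∀ j, (z j = 0 ∨ z j = 1) → G z j = 0) :
    ∫ z in unitCube (Fin (n + 1)), ∑ j, fderiv ℝ G z (EuclideanSpace.single j 1) j = 0 := by
  -- the field in the coordinates `Fin (n+1) → ℝ`
  set eqv : EuclideanSpace ℝ (Fin (n + 1)) ≃L[ℝ] (Fin (n + 1) → ℝ) :=
    EuclideanSpace.equiv (Fin (n + 1)) ℝ with heqv
  set f : (Fin (n + 1) → ℝ) → (Fin (n + 1) → ℝ) := fun x => eqv (G (eqv.symm x)) with hf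
  set f' : (Fin (n + 1) → ℝ) → (Fin (n + 1) → ℝ) →L[ℝ] (Fin (n + 1) → ℝ) := fun x =>
    ((eqv : EuclideanSpace ℝ (Fin (n + 1)) →L[ℝ] (Fin (n + 1) → ℝ)).comp
      (fderiv ℝ G (eqv.symm x))).comp
      (eqv.symm : (Fin (n + 1) → ℝ) →L[ℝ] EuclideanSpace ℝ (Fin (n + 1))) with hf'
  have hdiffG : Differentiable ℝ G := hG.differentiable one_ne_zero
  have hderiv : ∀ x, HasFDerivAt f (f' x) x := fun x =>
    (eqv.hasFDerivAt.comp _ (hdiffG (eqv.symm x)).hasFDerivAt).comp x eqv.symm.hasFDerivAt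
  have hcontf : Continuous f :=
    eqv.continuous.comp (hG.continuous.comp eqv.symm.continuous)
  -- the divergence in coordinates is the divergence
  have hdiv_eq : ∀ x, ∑ i, f' x (Pi.single i 1) i =
      ∑ j, fderiv ℝ G (WithLp.toLp 2 x) (EuclideanSpace.single j 1) j := by
    intro x
    refine Finset.sum_congr rfl fun i _ => ?_
    simp only [hf', ContinuousLinearMap.comp_apply, ContinuousLinearEquiv.coe_coe]
    rfl
  have hcont_div : Continuous fun x : Fin (n + 1) → ℝ =>
      ∑ j, fderiv ℝ G (WithLp.toLp 2 x) (EuclideanSpace.single j 1) j :=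
    continuous_finsetSum _ fun j _ =>
      (PiLp.continuous_apply 2 (fun _ : Fin (n + 1) => ℝ) j).comp
        (((hG.continuous_fderiv one_ne_zero).comp (PiLp.continuous_toLp 2 _)).clm_apply
          continuous_const)
  have hDT := integral_divergence_of_hasFDerivAt_off_countable (0 : Fin (n + 1) → ℝ) 1
    zero_le_one f f' ∅ countable_empty hcontf.continuousOn (fun x _ => hderiv x)
    (by
      simp_rw [hdiv_eq]
      exact hcont_div.continuousOn.integrableOn_compact isCompact_Icc)
  -- every face term vanishes
  have hfaces : ∀ i : Fin (n + 1), ∀ c : ℝ, (c = 0 ∨ c = 1) →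
      (∫ x in Icc ((0 : Fin (n + 1) → ℝ) ∘ Fin.succAbove i) ((1 : Fin (n + 1) → ℝ) ∘ Fin.succAbove i),
        f (Fin.insertNth i c x) i) = 0 := by
    intro i c hc
    refine setIntegral_eq_zero_of_forall_eq_zero fun x hx => ?_
    have hmem : ∀ k,
        (WithLp.toLp 2 (Fin.insertNth i c x) : EuclideanSpace ℝ (Fin (n + 1))) k ∈ Icc (0 : ℝ) 1 := by
      intro k
      show (Fin.insertNth i c x : Fin (n + 1) → ℝ) k ∈ Icc (0 : ℝ) 1
      refine Fin.succAboveCases i ?_ (fun j => ?_) k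
      · rw [Fin.insertNth_apply_same]
        rcases hc with rfl | rfl <;> norm_num
      · rw [Fin.insertNth_apply_succAbove]
        exact ⟨hx.1 j, hx.2 j⟩
    have hk : (WithLp.toLp 2 (Fin.insertNth i c x) : EuclideanSpace ℝ (Fin (n + 1))) i = 0 ∨
        (WithLp.toLp 2 (Fin.insertNth i c x) : EuclideanSpace ℝ (Fin (n + 1))) i = 1 := by
      show (Fin.insertNth i c x : Fin (n + 1) → ℝ) i = 0 ∨
        (Fin.insertNth i c x : Fin (n + 1) → ℝ) i = 1
      rw [Fin.insertNth_apply_same]; exact hc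
    exact htan _ hmem i hk
  have hRHS : (∑ i : Fin (n + 1),
      ((∫ x in Icc ((0 : Fin (n + 1) → ℝ) ∘ Fin.succAbove i) ((1 : Fin (n + 1) → ℝ) ∘ Fin.succAbove i),
          f (Fin.insertNth i ((1 : Fin (n + 1) → ℝ) i) x) i) -
        ∫ x in Icc ((0 : Fin (n + 1) → ℝ) ∘ Fin.succAbove i) ((1 : Fin (n + 1) → ℝ) ∘ Fin.succAbove i),
          f (Fin.insertNth i ((0 : Fin (n + 1) → ℝ) i) x) i)) = 0 := by
    refine Finset.sum_eq_zero fun i _ => ?_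
    rw [Pi.one_apply, Pi.zero_apply, hfaces i 1 (Or.inr rfl), hfaces i 0 (Or.inl rfl), sub_zero]
  rw [hRHS] at hDT
  simp_rw [hdiv_eq] at hDT
  -- transport the integral to `EuclideanSpace`
  have hpre : unitCube (Fin (n + 1)) =
      (WithLp.ofLp : EuclideanSpace ℝ (Fin (n + 1)) → Fin (n + 1) → ℝ) ⁻¹'
        Set.pi univ fun _ => Ico (0 : ℝ) 1 := by
    ext z; simp [mem_unitCube]
  have hemb :
      MeasurableEmbedding (WithLp.ofLp : EuclideanSpace ℝ (Fin (n + 1)) → Fin (n + 1) → ℝ) :=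
    (MeasurableEquiv.toLp 2 (Fin (n + 1) → ℝ)).symm.measurableEmbedding
  have key := (PiLp.volume_preserving_ofLp (Fin (n + 1))).setIntegral_preimage_emb hemb
    (fun x : Fin (n + 1) → ℝ => ∑ j, fderiv ℝ G (WithLp.toLp 2 x) (EuclideanSpace.single j 1) j)
    (Set.pi univ fun _ => Ico (0 : ℝ) 1)
  have hae : (Set.pi univ fun _ : Fin (n + 1) => Ico (0 : ℝ) 1) =ᵐ[volume]
      Icc (0 : Fin (n + 1) → ℝ) 1 := by
    rw [volume_pi]
    exact Measure.univ_pi_Ico_ae_eq_Icc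
  rw [← hpre, setIntegral_congr_set hae, hDT] at key
  simpa only [WithLp.toLp_ofLp] using key

/-! ## Conservation -/

/-- **Conservation of the cell integral of a transported scalar.** Let `V`, `H` be jointly `C¹`
on `ℝ × ℝ^{n+1}`; on `[a,b] × [0,1]^{n+1}` let `V(t)` be divergence free and tangent to the
boundary of the cube and `∂ₜH + DH[V] = 0`. Then `∫_{[0,1)^{n+1}} H(t) = ∫_{[0,1)^{n+1}} H(a)`
for every `t ∈ [a,b]` (ACM 2019, Remark 24 (iv); BDL 2023, §4.1 (ii)).
[cite: AlbertiCrippaMazzucato2019, Remark 24 (iv)] -/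
theorem setIntegral_unitCube_eq_of_transport {V : ℝ → EuclideanSpace ℝ (Fin (n + 1)) → EuclideanSpace ℝ (Fin (n + 1))}
    {H : ℝ → EuclideanSpace ℝ (Fin (n + 1)) → ℝ} {a b : ℝ}
    (hV : ContDiff ℝ 1 (uncurry V)) (hH : ContDiff ℝ 1 (uncurry H))
    (hdiv : ∀ t ∈ Icc a b, ∀ z : EuclideanSpace ℝ (Fin (n + 1)), (∀ k, z k ∈ Icc (0 : ℝ) 1) →
      ∑ j, fderiv ℝ (V t) z (EuclideanSpace.single j 1) j = 0)
    (htan : ∀ t ∈ Icc a b, ∀ z : EuclideanSpace ℝ (Fin (n + 1)), (∀ k, z k ∈ Icc (0 : ℝ) 1) →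
      ∀ j, (z j = 0 ∨ z j = 1) → V t z j = 0)
    (htr : ∀ t ∈ Icc a b, ∀ z : EuclideanSpace ℝ (Fin (n + 1)), (∀ k, z k ∈ Icc (0 : ℝ) 1) →
      deriv (fun s => H s z) t + fderiv ℝ (H t) z (V t z) = 0)
    {t : ℝ} (ht : t ∈ Icc a b) :
    ∫ z in unitCube (Fin (n + 1)), H t z = ∫ z in unitCube (Fin (n + 1)), H a z := by
  -- slices
  have hHs : ∀ s, ContDiff ℝ 1 (H s) := fun s => hH.comp (contDiff_prodMk_right s)
  have hVs : ∀ s, ContDiff ℝ 1 (V s) := fun s => hV.comp (contDiff_prodMk_right s)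
  have hHt : ∀ z, ContDiff ℝ 1 fun s => H s z := fun z => hH.comp (contDiff_prodMk_left z)
  -- a bump equal to `1` on the cube
  let χ : ContDiffBump (0 : EuclideanSpace ℝ (Fin (n + 1))) :=
    ⟨n + 1, n + 2, by positivity, by linarith⟩
  have hχ1 : ∀ z ∈ unitCube (Fin (n + 1)), (χ : EuclideanSpace ℝ (Fin (n + 1)) → ℝ) z = 1 :=
      fun z hz =>
    χ.one_of_mem_closedBall (by
      rw [mem_closedBall, dist_zero_right]
      exact norm_le_of_mem_Icc (unitCube_subset_setOf_mem_Icc hz))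
  set Φ : ℝ → EuclideanSpace ℝ (Fin (n + 1)) → ℝ := fun s z => χ z * H s z with hΦ
  have hΦC : ContDiffOn ℝ 1 (uncurry Φ) (univ ×ˢ univ) :=
    ((χ.contDiff.comp contDiff_snd).mul hH).contDiffOn
  have hΦsupp : ∀ s ∈ (univ : Set ℝ), ∀ z ∉ closedBall (0 : EuclideanSpace ℝ (Fin (n + 1))) (n + 2),
      Φ s z = 0 := by
    intro s _ z hz
    have : (χ : EuclideanSpace ℝ (Fin (n + 1)) → ℝ) z = 0 := χ.zero_of_le_dist (by
      rw [mem_closedBall, not_le] at hz; exact hz.le)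
    simp [hΦ, this]
  -- the cell integral and its derivative
  set F : ℝ → ℝ := fun s => ∫ z in unitCube (Fin (n + 1)), H s z with hF
  have hFeq : F = fun s => ∫ z, Φ s z ∂(volume.restrict (unitCube (Fin (n + 1)))) := by
    funext s
    exact (setIntegral_congr_fun measurableSet_unitCube fun z hz => by
      simp [hΦ, hχ1 z hz]).symm
  have hderF : ∀ s,
      HasDerivAt F (∫ z in unitCube (Fin (n + 1)), deriv (fun r => H r z) s) s := by
    intro s
    have h := hasDerivAt_integral_of_contDiffOn (μ := volume.restrict (unitCube (Fin (n + 1))))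
      isOpen_univ hΦC (isCompact_closedBall (0 : EuclideanSpace ℝ (Fin (n + 1))) (n + 2)) hΦsupp
      (mem_univ s)
    rw [← hFeq] at h
    have heq : (∫ z, deriv (fun r => Φ r z) s ∂(volume.restrict (unitCube (Fin (n + 1))))) =
        ∫ z in unitCube (Fin (n + 1)), deriv (fun r => H r z) s := by
      refine setIntegral_congr_fun measurableSet_unitCube fun z hz => ?_
      simp only [hΦ]
      rw [deriv_const_mul _ ((hHt z).differentiable one_ne_zero s), hχ1 z hz, one_mul]
    rwa [heq] at h
  -- on `[a,b]` the derivative vanishes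
  have hderF0 : ∀ s ∈ Icc a b, HasDerivAt F 0 s := by
    intro s hs
    have hG : ContDiff ℝ 1 fun z => H s z • V s z := (hHs s).smul (hVs s)
    have hint0 := integral_unitCube_divergence_eq_zero_of_tangent hG (fun z hz j hj => by
      show H s z • V s z j = 0
      rw [htan s hs z hz j hj, smul_zero])
    have heq : (∫ z in unitCube (Fin (n + 1)), deriv (fun r => H r z) s) =
        ∫ z in unitCube (Fin (n + 1)),
          -∑ j, fderiv ℝ (fun y => H s y • V s y) z (EuclideanSpace.single j 1) j := by
      refine setIntegral_congr_fun measurableSet_unitCube fun z hz => ?_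
      have hz' := unitCube_subset_setOf_mem_Icc hz
      have h1 := htr s hs z hz'
      have h2 := sum_fderiv_smul_apply ((hHs s).differentiable one_ne_zero z)
        ((hVs s).differentiable one_ne_zero z)
      rw [hdiv s hs z hz', mul_zero, add_zero] at h2
      simp only
      linarith
    have := hderF s
    rw [heq, integral_neg, hint0, neg_zero] at this
    exact this
  have hcontF : Continuous F := continuous_iff_continuousAt.2 fun s => (hderF s).continuousAt
  exact constant_of_has_deriv_right_zero hcontF.continuousOn
    (fun s hs => (hderF0 s (Ico_subset_Icc_self hs)).hasDerivWithinAt) t ht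

/-- **Conservation for `Φ ∘ Θ`.** If `Θ` is transported by `V` as above and `Φ : ℝ → ℝ` is `C¹`,
then `∫_{[0,1)^{n+1}} Φ(Θ(t,·))` is constant on `[a,b]` (`Φ ∘ Θ` is again transported).
[cite: AlbertiCrippaMazzucato2019, Remark 24 (iv)] -/
theorem setIntegral_unitCube_comp_eq_of_transport {V : ℝ → EuclideanSpace ℝ (Fin (n + 1)) → EuclideanSpace ℝ (Fin (n + 1))}
    {Θ : ℝ → EuclideanSpace ℝ (Fin (n + 1)) → ℝ}
    {Φ : ℝ → ℝ} {a b : ℝ} (hΦ : ContDiff ℝ 1 Φ)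
    (hV : ContDiff ℝ 1 (uncurry V)) (hΘ : ContDiff ℝ 1 (uncurry Θ))
    (hdiv : ∀ t ∈ Icc a b, ∀ z : EuclideanSpace ℝ (Fin (n + 1)), (∀ k, z k ∈ Icc (0 : ℝ) 1) →
      ∑ j, fderiv ℝ (V t) z (EuclideanSpace.single j 1) j = 0)
    (htan : ∀ t ∈ Icc a b, ∀ z : EuclideanSpace ℝ (Fin (n + 1)), (∀ k, z k ∈ Icc (0 : ℝ) 1) →
      ∀ j, (z j = 0 ∨ z j = 1) → V t z j = 0)
    (htr : ∀ t ∈ Icc a b, ∀ z : EuclideanSpace ℝ (Fin (n + 1)), (∀ k, z k ∈ Icc (0 : ℝ) 1) →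
      deriv (fun s => Θ s z) t + fderiv ℝ (Θ t) z (V t z) = 0)
    {t : ℝ} (ht : t ∈ Icc a b) :
    ∫ z in unitCube (Fin (n + 1)), Φ (Θ t z) = ∫ z in unitCube (Fin (n + 1)), Φ (Θ a z) := by
  have hH : ContDiff ℝ 1 (uncurry fun s z => Φ (Θ s z)) := hΦ.comp hΘ
  refine setIntegral_unitCube_eq_of_transport (H := fun s z => Φ (Θ s z)) hV hH hdiv htan
    (fun s hs z hz => ?_) ht
  have hΘs : ContDiff ℝ 1 (Θ s) := hΘ.comp (contDiff_prodMk_right s)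
  have hΘt : ContDiff ℝ 1 fun r => Θ r z := hΘ.comp (contDiff_prodMk_left z)
  have hdt : HasDerivAt (fun r => Θ r z) (deriv (fun r => Θ r z) s) s :=
    ((hΘt.differentiable one_ne_zero) s).hasDerivAt
  have hdΦ : HasDerivAt Φ (deriv Φ (Θ s z)) (Θ s z) :=
    ((hΦ.differentiable one_ne_zero) _).hasDerivAt
  have h1 : deriv (fun r => Φ (Θ r z)) s = deriv Φ (Θ s z) * deriv (fun r => Θ r z) s :=
    (hdΦ.comp s hdt).deriv
  have h2 : fderiv ℝ (fun y => Φ (Θ s y)) z (V s z) =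
      deriv Φ (Θ s z) * fderiv ℝ (Θ s) z (V s z) := by
    have hz' : DifferentiableAt ℝ (Θ s) z := (hΘs.differentiable one_ne_zero) z
    have hcomp : (fun y => Φ (Θ s y)) = Φ ∘ Θ s := rfl
    rw [hcomp, fderiv_comp z ((hΦ.differentiable one_ne_zero) _) hz',
      ContinuousLinearMap.comp_apply,
      hdΦ.hasFDerivAt.fderiv]
    simp [smul_eq_mul, mul_comm]
  show deriv (fun r => Φ (Θ r z)) s + fderiv ℝ (fun y => Φ (Θ s y)) z (V s z) = 0
  rw [h1, h2, ← mul_add, htr s hs z hz, mul_zero]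

/-- **Conservation of the average** of a transported scalar: `∫_{[0,1)^{n+1}} Θ(t) = ∫ Θ(a)`,
`t ∈ [a,b]` (BDL 2023, §4.1 (ii): zero average for every `t`).
[cite: BrueDeLellisCMP2023, §4.1 (ii)] -/
theorem setIntegral_unitCube_eq_of_transport' {V : ℝ → EuclideanSpace ℝ (Fin (n + 1)) → EuclideanSpace ℝ (Fin (n + 1))}
    {Θ : ℝ → EuclideanSpace ℝ (Fin (n + 1)) → ℝ} {a b : ℝ}
    (hV : ContDiff ℝ 1 (uncurry V)) (hΘ : ContDiff ℝ 1 (uncurry Θ))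
    (hdiv : ∀ t ∈ Icc a b, ∀ z : EuclideanSpace ℝ (Fin (n + 1)), (∀ k, z k ∈ Icc (0 : ℝ) 1) →
      ∑ j, fderiv ℝ (V t) z (EuclideanSpace.single j 1) j = 0)
    (htan : ∀ t ∈ Icc a b, ∀ z : EuclideanSpace ℝ (Fin (n + 1)), (∀ k, z k ∈ Icc (0 : ℝ) 1) →
      ∀ j, (z j = 0 ∨ z j = 1) → V t z j = 0)
    (htr : ∀ t ∈ Icc a b, ∀ z : EuclideanSpace ℝ (Fin (n + 1)), (∀ k, z k ∈ Icc (0 : ℝ) 1) →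
      deriv (fun s => Θ s z) t + fderiv ℝ (Θ t) z (V t z) = 0)
    {t : ℝ} (ht : t ∈ Icc a b) :
    ∫ z in unitCube (Fin (n + 1)), Θ t z = ∫ z in unitCube (Fin (n + 1)), Θ a z :=
  setIntegral_unitCube_comp_eq_of_transport (Φ := id) contDiff_id hV hΘ hdiv htan htr ht

/-- **Conservation of the `L²` mass** of a transported scalar: `∫_{[0,1)^{n+1}} Θ(t)² = ∫ Θ(a)²`,
`t ∈ [a,b]` (BDL 2023, §4.1 (ii): `∫ Θ_i² = 1` for every `t`).
[cite: BrueDeLellisCMP2023, §4.1 (ii)] -/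
theorem setIntegral_unitCube_sq_eq_of_transport {V : ℝ → EuclideanSpace ℝ (Fin (n + 1)) → EuclideanSpace ℝ (Fin (n + 1))}
    {Θ : ℝ → EuclideanSpace ℝ (Fin (n + 1)) → ℝ} {a b : ℝ}
    (hV : ContDiff ℝ 1 (uncurry V)) (hΘ : ContDiff ℝ 1 (uncurry Θ))
    (hdiv : ∀ t ∈ Icc a b, ∀ z : EuclideanSpace ℝ (Fin (n + 1)), (∀ k, z k ∈ Icc (0 : ℝ) 1) →
      ∑ j, fderiv ℝ (V t) z (EuclideanSpace.single j 1) j = 0)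
    (htan : ∀ t ∈ Icc a b, ∀ z : EuclideanSpace ℝ (Fin (n + 1)), (∀ k, z k ∈ Icc (0 : ℝ) 1) →
      ∀ j, (z j = 0 ∨ z j = 1) → V t z j = 0)
    (htr : ∀ t ∈ Icc a b, ∀ z : EuclideanSpace ℝ (Fin (n + 1)), (∀ k, z k ∈ Icc (0 : ℝ) 1) →
      deriv (fun s => Θ s z) t + fderiv ℝ (Θ t) z (V t z) = 0)
    {t : ℝ} (ht : t ∈ Icc a b) :
    ∫ z in unitCube (Fin (n + 1)), Θ t z ^ 2 = ∫ z in unitCube (Fin (n + 1)), Θ a z ^ 2 :=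
  setIntegral_unitCube_comp_eq_of_transport (Φ := fun r => r ^ 2) (contDiff_id.pow 2) hV hΘ
    hdiv htan htr ht

end BoxTransport

end Literature.Analysis.FluidPDE

end
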